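import Summits.BirchSwinnertonDyer.BirchSwinnertonDyer.Theorems.Rank2Observatory2DescClFieldCert
import HarnessLib

/-!
# BirchSwinnertonDyer — rank ≥ 2 observatory: KERNEL-2DESC-CL Q2 — the per-field certificate with TWO auxiliary primes (`ClFieldCertQ2`), part 1: the field layer

HONEST FRAMING: per-curve certified theorems and census instruments; no claim on BSD in rank ≥ 2.

The v2.0 per-field record `ClFieldCert` (`Rank2Observatory2DescClFieldCert`) carries ONE auxiliary prime
`q = W₁W₂` whose degree-one prime generates the class group — which forces `Cl(K)` cyclic and leaves the
2 501 census curves over cubic fields with a NON-CYCLIC class group (two generators; `cyc` 2·2, 4·2, 6·2, …)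
outside every tranche (`generics/q2/Q2-SPEC.md`).  Nothing in the soundness chain uses cyclicity except the
CHOICE of one `q`: the abstract rank bound (`mordellWeilRank_le_of_coverSet_cl_lt`) only needs the classes of
the ideals containing the modulus to GENERATE `Cl(K)`.  `ClFieldCertQ2` is the same record with TWO auxiliary
primes `q₁ = W₁₁W₁₂`, `q₂ = W₂₁W₂₂` (both of splitting pattern `{1, 2}`, two copies of the `q`-plumbing), two
elements `γ₁, γ₂` for the family layer (part 2), and class certificates of the registry codes RELATIVE TO BOTH:
`β ∈ P` with `|N(β)| = N(P) · q₁^j · q₂^k` (`classCheck₂`; the exponent pair is carried in the existing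
`PrimeEntry.cls` slot as `j + 64·k`, so the landed registry row type is reused unchanged).  This file proves the
field-level consequences exactly as part 3 of v2.0 does, with

* `closure_q2_eq_top_of_check` — **the classes of the ideals containing `q₁·q₂` generate `Cl(K)`** (Minkowski
  sweep `eq_top_of_classIn_lt`: a sweep prime is `q₁`, `q₂`, or a registry prime whose codes inside the range
  carry a two-prime relation certificate; `classIn_tsupp₂_of_absNorm_dvd`, `classIn_of_classCheck₂`);
* the primes above `q₁` and `q₂` (`w₁₁/w₁₂/w₂₁/w₂₂_of_check`, `qcover₁/₂_of_check`), irreducibility, `Δ < 0`,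
  the real place, unit rank `1`, the residue characters — verbatim.

The class-group STRUCTURE never enters (PARI's `cyc` is used only by the producer to pick `q₁, q₂`).
Sorry-free; new declarations only; axioms `propext`, `Classical.choice`, `Quot.sound`.
[cite: Cohen1993, §4.8.2, §6.5] [cite: Marcus2018, Ch. 5, Thm. 35 and Cor. 2, Thm. 37, Thm. 38] [cite: Cassels1991LecturesEllipticCurves, §15]
-/

set_option linter.dupNamespace false

noncomputable section

open scoped Classical NumberField nonZeroDivisors

open Literature.NumberTheory.NumberFields Polynomial Module NumberField IsDedekindDomain Ideal

namespace Summit.BirchSwinnertonDyer.BirchSwinnertonDyer.Rank2Observatory.TwoDescCl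

open TwoDescCubic

section TwoPrimes

variable {K : Type*} [Field K] [NumberField K]

/-! ## Classes relative to two auxiliary primes -/

/-- The subgroup `H_N` generated by the classes of the ideals containing `N`. -/
abbrev tsuppClosure (N : 𝓞 K) : Subgroup (ClassGroup (𝓞 K)) :=
  Subgroup.closure {c : ClassGroup (𝓞 K) | ∃ (J : Ideal (𝓞 K)) (hJ : J ∈ (Ideal (𝓞 K))⁰),
    N ∈ J ∧ ClassGroup.mk0 ⟨J, hJ⟩ = c}

/-- `ClassIn` is monotone in the subgroup. [folklore] -/
theorem ClassIn.of_le {H H' : Subgroup (ClassGroup (𝓞 K))} (h : H ≤ H') {I : Ideal (𝓞 K)}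
    (hI : ClassIn H I) : ClassIn H' I := fun h0 => h (hI h0)

/-- `H_N ≤ H_{N'}` when `N ∣ N'`. [folklore] -/
theorem tsuppClosure_mono {N N' : 𝓞 K} (h : N ∣ N') : tsuppClosure N ≤ tsuppClosure N' := by
  refine Subgroup.closure_mono ?_
  rintro c ⟨J, hJ, hN, rfl⟩
  obtain ⟨u, rfl⟩ := h
  exact ⟨J, hJ, J.mul_mem_right u hN, rfl⟩

/-- `H_{q₁} ≤ H_{q₁q₂}`. -/
theorem tsuppClosure_le_mul_left (q₁ q₂ : ℕ) :
    tsuppClosure (K := K) ((q₁ : ℕ) : 𝓞 K) ≤ tsuppClosure (((q₁ * q₂ : ℕ) : ℕ) : 𝓞 K) :=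
  tsuppClosure_mono ⟨(q₂ : 𝓞 K), by push_cast; ring⟩

/-- `H_{q₂} ≤ H_{q₁q₂}`. -/
theorem tsuppClosure_le_mul_right (q₁ q₂ : ℕ) :
    tsuppClosure (K := K) ((q₂ : ℕ) : 𝓞 K) ≤ tsuppClosure (((q₁ * q₂ : ℕ) : ℕ) : 𝓞 K) :=
  tsuppClosure_mono ⟨(q₁ : 𝓞 K), by push_cast; ring⟩

/-- **Primes of `q₁^j q₂^k`-dividing norm lie in `H_{q₁q₂}`.** [cite: Marcus2018, Ch. 3, Thm. 22] -/
theorem classIn_tsupp₂_of_absNorm_dvd {q₁ q₂ : ℕ} (hq₁ : q₁.Prime) (hq₂ : q₂.Prime) {j k : ℕ}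
    (P : Ideal (𝓞 K)) (hP : P.IsPrime) (hP0 : P ≠ ⊥) (h : absNorm P ∣ q₁ ^ j * q₂ ^ k) :
    ClassIn (tsuppClosure (((q₁ * q₂ : ℕ) : ℕ) : 𝓞 K)) P := by
  obtain ⟨r, hr, hrP⟩ := Nat.exists_prime_and_dvd (one_lt_absNorm hP hP0).ne'
  have hrq : r ∣ q₁ ^ j * q₂ ^ k := hrP.trans h
  have hmemr : ((r : ℕ) : 𝓞 K) ∈ P := natCast_mem_of_dvd_absNorm ⟨P, hP, hP0⟩ hr hrP
  rcases (Nat.Prime.dvd_mul hr).mp hrq with h1 | h2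
  · have : r = q₁ := (Nat.prime_dvd_prime_iff_eq hr hq₁).mp (hr.dvd_of_dvd_pow h1)
    subst this
    exact ClassIn.of_le (tsuppClosure_le_mul_left r q₂) (classIn_closure_of_mem hmemr)
  · have : r = q₂ := (Nat.prime_dvd_prime_iff_eq hr hq₂).mp (hr.dvd_of_dvd_pow h2)
    subst this
    exact ClassIn.of_le (tsuppClosure_le_mul_right q₁ r) (classIn_closure_of_mem hmemr)

/-- **Class certificate of one code relative to TWO auxiliary primes**: `β = x + yα + zα² ∈ (p, G(α))` with
`|N β| = N(p, G(α)) · q₁^j · q₂^k`, the exponent pair packed as `d.2.2.2 = j + 64·k`; inert codes and codes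
outside the Minkowski range need none.  Computable. [cite: Cohen1993, §6.5 (relations)] -/
def classCheck₂ (a b c : ℤ) (q₁ q₂ bM : ℕ) (C : PCode) (d : ℤ × ℤ × ℤ × ℕ) : Bool :=
  decide (bM ≤ C.1 ^ codeDeg C) || decide (codeDeg C = 3) ||
    (memCode C (d.1, d.2.1, d.2.2.1) &&
      decide ((normFormZ a b c d.1 d.2.1 d.2.2.1).natAbs =
        C.1 ^ codeDeg C * (q₁ ^ (d.2.2.2 % 64) * q₂ ^ (d.2.2.2 / 64))))

variable {a b c : ℤ} {θ : K}

/-- Soundness of the two-prime class certificate: `p ^ f(P) < bM → ClassIn H_{q₁q₂} P`.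
[cite: Marcus2018, Ch. 5, Cor. 2 to Thm. 35] -/
theorem classIn_of_classCheck₂ (hirr : Irreducible (MonicCubic.polyQ a b c))
    (hθ : aeval θ (MonicCubic.poly a b c) = 0) (h3 : finrank ℚ K = 3) {e : PrimeEntry} (hp : e.p.Prime)
    (h : e.check a b c = true) {C : PCode} (hC : C ∈ e.codes) {q₁ q₂ : ℕ} (hq₁ : q₁.Prime) (hq₂ : q₂.Prime)
    {bM : ℕ} {d : ℤ × ℤ × ℤ × ℕ} (hd : classCheck₂ a b c q₁ q₂ bM C d = true)
    (hlt : e.p ^ (idealOf hθ C).inertiaDeg ℤ < bM) :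
    ClassIn (tsuppClosure (((q₁ * q₂ : ℕ) : ℕ) : 𝓞 K)) (idealOf hθ C) := by
  have hPO := mem_primesOver_of_check hirr hθ h3 hp h hC
  have habs := absNorm_of_check hirr hθ h3 hp h hC
  have hfst := code_fst_of_mem hC
  simp only [classCheck₂, Bool.or_eq_true, Bool.and_eq_true, decide_eq_true_eq] at hd
  rcases hd with (hb | h3') | ⟨hmem, hN⟩
  · exact absurd hlt (not_pow_inertiaDeg_lt hPO habs (hfst ▸ hb))
  · -- inert: principal — through the one-prime lemma (its `codeDeg C = 3` branch) and monotonicity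
    have h1 := classIn_of_classCheck hirr hθ h3 hp h hC hq₁ (bM := bM) (d := (0, 0, 0, 0))
      (by simp [classCheck, h3']) hlt
    exact ClassIn.of_le (tsuppClosure_le_mul_left q₁ q₂) h1
  · have hβ := lin_mem_idealOf_of_memCode hθ C _ hmem
    have hP := isPrime_and_ne_bot_of_check hirr hθ h3 hp h hC
    refine ClassIn.of_mem_of_absNorm hP.2 hβ (m := q₁ ^ (d.2.2.2 % 64) * q₂ ^ (d.2.2.2 / 64))
      (Nat.mul_pos (pow_pos hq₁.pos _) (pow_pos hq₂.pos _)) ?_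
      fun Q hQ hQ0 hdvd => classIn_tsupp₂_of_absNorm_dvd hq₁ hq₂ Q hQ hQ0 hdvd
    rw [natAbs_norm_lin_coords hirr hθ h3, habs, ← hfst]
    exact hN

end TwoPrimes

/-! ## The record -/

/-- **Per-field certificate with two auxiliary primes** `q₁ = W₁₁W₁₂`, `q₂ = W₂₁W₂₂` (complex monogenic cubic
field; the classes of the four primes generate `Cl(K)`).  Pure data. [cite: Cohen1993, §6.5] -/
structure ClFieldCertQ2 where
  /-- `g = X³ + aX² + bX + c` -/
  a : ℤ
  /-- `g = X³ + aX² + bX + c` -/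
  b : ℤ
  /-- `g = X³ + aX² + bX + c` -/
  c : ℤ
  /-- a modulus modulo which `g` has no root (irreducibility) -/
  pIrr : ℕ
  /-- isolating interval `0 ≤ lo < α < hi` of the real root -/
  lo : ℚ
  /-- isolating interval `0 ≤ lo < α < hi` of the real root -/
  hi : ℚ
  /-- Minkowski range: `64·|Δ(g)| < 799·bM²` -/
  bM : ℕ
  /-- the first auxiliary prime `q₁ = W₁₁W₁₂` -/
  q₁ : ℕ
  /-- `(r, u, v)`: `g ≡ (X − r)(X² + uX + v) (mod q₁)` -/
  qr₁ : ℤ × ℤ × ℤ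
  /-- cofactor coefficients of that congruence -/
  qs₁ : ℤ × ℤ × ℤ
  /-- the second auxiliary prime `q₂ = W₂₁W₂₂` -/
  q₂ : ℕ
  /-- `(r, u, v)`: `g ≡ (X − r)(X² + uX + v) (mod q₂)` -/
  qr₂ : ℤ × ℤ × ℤ
  /-- cofactor coefficients of that congruence -/
  qs₂ : ℤ × ℤ × ℤ
  /-- residue characters `(ℓ, t, dinv)`: `g(t) ≡ 0`, `dinv · |Δ(g)| ≡ 1 (mod ℓ)` -/
  chars : List (ℕ × ℤ × ℤ)
  /-- the fundamental unit `ε`; certified per curve by the family checker (part 2) -/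
  fu : ElemEntry
  /-- the element `γ₁` supported on the auxiliary primes; certified per curve by the family checker (part 2) -/
  gam₁ : ElemEntry
  /-- the element `γ₂` supported on the auxiliary primes; certified per curve by the family checker (part 2) -/
  gam₂ : ElemEntry
  /-- registry rows of the rational primes (sweep primes and the primes met by the curves), never `q₁`, `q₂`;
  class certificates `(x, y, z, j + 64·k)` relative to `q₁, q₂` -/
  primes : List PrimeEntry

namespace ClFieldCertQ2

variable (fc : ClFieldCertQ2)

/-- The registry row of `q₁` (type `1`). -/
def qEntry₁ : PrimeEntry := ⟨fc.q₁, 1, fc.qr₁, fc.qs₁, [], []⟩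

/-- The registry row of `q₂` (type `1`). -/
def qEntry₂ : PrimeEntry := ⟨fc.q₂, 1, fc.qr₂, fc.qs₂, [], []⟩

/-- Code of `W₁₁ = (q₁, α − r₁)`. -/
def w₁₁ : PCode := (fc.q₁, -fc.qr₁.1, 1, 0)

/-- Code of `W₁₂ = (q₁, α² + u₁α + v₁)`. -/
def w₁₂ : PCode := (fc.q₁, fc.qr₁.2.2, fc.qr₁.2.1, 1)

/-- Code of `W₂₁ = (q₂, α − r₂)`. -/
def w₂₁ : PCode := (fc.q₂, -fc.qr₂.1, 1, 0)

/-- Code of `W₂₂ = (q₂, α² + u₂α + v₂)`. -/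
def w₂₂ : PCode := (fc.q₂, fc.qr₂.2.2, fc.qr₂.2.1, 1)

/-- The primes whose primality the row files discharge by `norm_num`: `q₁`, `q₂`, the character moduli, the
registry primes. -/
def primeList : List ℕ := fc.q₁ :: fc.q₂ :: ((fc.chars.map fun ch => ch.1) ++ fc.primes.map PrimeEntry.p)

/-- Field clause: irreducibility, `Δ < 0`, the isolating interval. Computable. -/
def checkField : Bool :=
  noRootMod fc.pIrr fc.a fc.b fc.c && decide (MonicCubic.disc fc.a fc.b fc.c < 0) &&
    decide (0 ≤ fc.lo ∧ fc.lo < fc.hi ∧ fc.lo ^ 3 + (fc.a : ℚ) * fc.lo ^ 2 + (fc.b : ℚ) * fc.lo + (fc.c : ℚ) < 0 ∧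
      0 < fc.hi ^ 3 + (fc.a : ℚ) * fc.hi ^ 2 + (fc.b : ℚ) * fc.hi + (fc.c : ℚ))

/-- Sweep clause: the Minkowski inequality, coverage of every prime `p < bM` by `q₁`, `q₂` or a registry row,
and a two-prime class certificate for every code of every registry row inside the range. Computable.
[cite: Marcus2018, Ch. 5, Cor. 2 to Thm. 35] -/
def checkSweep : Bool :=
  decide (64 * |MonicCubic.disc fc.a fc.b fc.c| < 799 * (fc.bM : ℤ) ^ 2) &&
    ((List.range fc.bM).all fun n =>
      decide (n < 2) || ClFieldCert.smallFactor n || n == fc.q₁ || n == fc.q₂ ||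
        fc.primes.any fun e => e.p == n) &&
    fc.primes.all fun e => decide (fc.bM ≤ e.p) ||
      e.codes.all fun C => e.cls.any fun d => classCheck₂ fc.a fc.b fc.c fc.q₁ fc.q₂ fc.bM C d

/-- Registry clause: the rows of `q₁`, `q₂` and every registry row are checked; `q₁ ≠ q₂`; registry primes
are neither. -/
def checkRegistry : Bool :=
  fc.qEntry₁.check fc.a fc.b fc.c && fc.qEntry₂.check fc.a fc.b fc.c && (fc.q₁ != fc.q₂) &&
    fc.primes.all fun e => e.check fc.a fc.b fc.c && e.p != fc.q₁ && e.p != fc.q₂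

/-- Character clause: `ℓ > 2`, `g(t) ≡ 0 (mod ℓ)`, `dinv·|Δ| ≡ 1 (mod ℓ)`. Computable.
[cite: Marcus2018, Ch. 3, Thm. 27] -/
def checkChars : Bool :=
  fc.chars.all fun ch => decide (2 < ch.1) &&
    decide ((ch.2.1 ^ 3 + fc.a * ch.2.1 ^ 2 + fc.b * ch.2.1 + fc.c) % (ch.1 : ℤ) = 0) &&
    decide (((MonicCubic.disc fc.a fc.b fc.c).natAbs : ℤ) * ch.2.2 % (ch.1 : ℤ) = 1)

/-- **The per-field checker (two auxiliary primes).** Computable; run once per field by `decide +kernel`. -/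
def check : Bool := fc.checkField && fc.checkSweep && fc.checkRegistry && fc.checkChars

end ClFieldCertQ2

end Summit.BirchSwinnertonDyer.BirchSwinnertonDyer.Rank2Observatory.TwoDescCl
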